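import Summits.QuantumFields.GaugeBoot.StrongCouplingPlaquetteSU3ThirdPieces
import HarnessLib

/-!
# Strong coupling from the loop equation, VI″: the `SU(2)` plaquette through third order — NO `β²` TERM: `⟨ū_P⟩ = β_std/4 + O(β_std³)` (gauge-boot, ADDENDUM 24 part I)

HONEST FRAMING (cell `pub-gaugeboot`, page 1 of every file): the venture produces certified bounds
on lattice expectations at stated coupling, gauge group, dimension and torus size; NOT a mass gap,
NOT a continuum limit, NOT a string tension; NOT Yang–Mills-summit-bearing (barriers
`FixedCouplingUltralocality`, `PerturbativeInvisibility`).  An analytic STRONG-COUPLING statement with explicit,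
volume-independent (crude) constants, valid for every torus side `L ≥ 2` and every real coupling; informative only for
small `β_std` and certifying no number of CERTIFIED.md.

## Content (`SU(2)`, fundamental representation, torus `(ℤ/L)^d`, `d ≥ 2`, `L ≥ 2`; tree coupling `β = β_std/2`, `t = tr U_P`)

Three loop-equation steps, as for `SU(3)` (ADDENDUM 24), but the `SU(2)` cubic sector is trivial: `tr U⁻¹ = tr U`,
`tr U² = t² − 2`, `tr U³ = t³ − 3t` (tree `trace_mul_trace_su_two`), and the Haar value of `E[t³]` is `0`:

* `norm_integral_trace_cube_su_two_le` — ★ `‖E[(tr U_P)³]‖ ≤ 15(d−1)|β|` (the doubly-wound plaquette with spectator: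
  `(5/2)κ − 4τ = O(β)`);
* `norm_selfSpectatorSum_su_two_le` — `‖ΣΣE[plaqTerm(P̃₀)·t]‖ ≤ (37 + (128/3)(2d−3))(d−1)|β|`, whence `E[t²] = 1 + O(β²)`;
* ★★ `integral_trace_sub_eq_su_two` — the exact identity `τ − β = (β²/12)·S₁ − (β/3)·Σ'T`;
* ★★★ `abs_wilsonExpectation_meanPlaquette_su_two_third_le` — **`|⟨ū_P⟩_{β,L} − β/2| ≤ 20d²(d−1)|β|³`** (tree coupling);
* ★★★ `abs_plaquetteExpectation_two_third_le` — **`|plaquetteExpectation 2 D L β_std − β_std/4| ≤ (5/2)D²(D−1)|β_std|³`**, `T2`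
  (`D = 4`): `≤ 120|β_std|³` — the strong-coupling series of the `SU(2)` plaquette
  (`u = I₂(β_std)/I₁(β_std) = β_std/4 − β_std³/96 + …` plus lattice corrections from order `β_std⁵`) has NO `β_std²` term: a theorem
  with an explicit, volume-uniform remainder (ADDENDUM 22 had `|… − β/4| ≤ 43β²/3`).

References: Balian–Drouffe–Itzykson, Phys. Rev. D 11 (1975) 2104; Creutz, *Quarks, gluons and lattices* (1983) Ch. 8–10.  `[folklore]`.
-/

noncomputable section
open MeasureTheory Filter Topology NormedSpace
open scoped Matrix.Norms.Frobenius Matrix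
open Literature.MathematicalPhysics.QuantumFieldTheory Literature.MathematicalPhysics.QuantumLattice
open Summit.QuantumFields.YangMills.Cruxes.CurvatureAmnesia.WardDefect.SchwingerDyson

namespace Summit.QuantumFields.GaugeBoot
namespace StrongCoupling

variable {d L : ℕ} [NeZero L]

/-- For `(ν, ε) ≠ (ν₀, +)`, `ν ≠ μ` (`SU(2)`): `‖E[plaqTerm_{ν,ε}(P̃₀)·tr U_P]‖ ≤ (128/3)(d−1)|β|` (read-once bounds at the
private links of `q`). [folklore] -/
theorem norm_integral_plaqTerm_mul_trace_su_two_le₁ (hL : (1 : ZMod L) ≠ 0) (β : ℝ) (x : Site d L) {μ ν₀ ν : Fin d}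
    (hμν₀ : μ ≠ ν₀) (hνμ : ν ≠ μ) {ε : Bool} (hne : ¬(ν = ν₀ ∧ ε = true)) :
    ‖∫ U, plaqTerm (fundamentalRep (Fin 2)) 1 x μ U (plaqWord μ ν₀ true) ν ε *
        (fundamentalRep (Fin 2) (wordHolonomy U x (plaqWord μ ν₀ true))).trace
          ∂(wilsonMeasure (d := d) (L := L) (fundamentalRep (Fin 2)) β)‖ ≤ 128 / 3 * ((d : ℝ) - 1) * |β| := by
  have hN : 2 ≤ 2 := le_rfl
  have hP : qEdge x μ ν ε ∉ Word.edgesRead x (plaqWord μ ν₀ true) := (qEdge_not_mem_plaqWordZero hL x hμν₀ hνμ hne).1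
  have gP := mulData_trace (N := 2) x (plaqWord μ ν₀ true) hP
  rw [integral_plaqTerm_mul_trace_suN]
  have hsw : ∀ (w : Word d) (U : GaugeConfig d L (Matrix.specialUnitaryGroup (Fin 2) ℂ)),
      (fundamentalRep (Fin 2) (wordHolonomy U x (plaqWord μ ν₀ true))).trace *
          (fundamentalRep (Fin 2) (wordHolonomy U x w)).trace *
          (fundamentalRep (Fin 2) (wordHolonomy U x (plaqWord μ ν₀ true))).trace =
        (fundamentalRep (Fin 2) (wordHolonomy U x w)).trace *
          ((fundamentalRep (Fin 2) (wordHolonomy U x (plaqWord μ ν₀ true))).trace *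
            (fundamentalRep (Fin 2) (wordHolonomy U x (plaqWord μ ν₀ true))).trace) := fun w U => by ring
  simp_rw [hsw]
  have h1 := norm_integral_trace_plaqWord_append_qw_mul_le (d := d) (L := L) hN hL β x hμν₀ hνμ hne (Or.inl rfl) gP
  have h2 := norm_integral_trace_plaqWord_append_qw_mul_le (d := d) (L := L) hN hL β x hμν₀ hνμ hne (Or.inr rfl) gP
  have h3 := norm_integral_trace_qw_mul_le (d := d) (L := L) hN hL β x hνμ ε (Or.inl rfl) (mulData_mul gP gP)
  have h4 := norm_integral_trace_qw_mul_le (d := d) (L := L) hN hL β x hνμ ε (Or.inr rfl) (mulData_mul gP gP)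
  refine (norm_four_piece_le h1 h2 h3 h4).trans (le_of_eq ?_)
  norm_num
  ring

/-- `‖E[tr U_P]‖ ≤ 16(d−1)|β|/3` for the `SU(2)` plaquette word. [folklore] -/
theorem norm_integral_trace_plaqWord_su_two_le (hL : (1 : ZMod L) ≠ 0) (β : ℝ) (x : Site d L) {μ ν₀ : Fin d} (hμν₀ : μ ≠ ν₀) :
    ‖∫ U, (fundamentalRep (Fin 2) (wordHolonomy U x (plaqWord μ ν₀ true))).trace
        ∂(wilsonMeasure (d := d) (L := L) (fundamentalRep (Fin 2)) β)‖ ≤ 16 * ((d : ℝ) - 1) * |β| / 3 := by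
  have h := norm_integral_trace_suN_le (d := d) (L := L) (N := 2) le_rfl β x μ (plaqWord μ ν₀ true) (endpoint_plaqWord x μ ν₀ true)
    (fun U => by simpa using Equipartition.sum_splitTerm_plaqWord (fundamentalRep (Fin 2)) hL 1 x hμν₀ U true)
  refine h.trans (le_of_eq ?_)
  ring

/-- ★ **`SU(2)`: `‖E[(tr U_P)³]‖ ≤ 15(d−1)|β|`** (Haar value `0`): the doubly-wound plaquette with spectator gives
`(5/2)E[t³] − 4E[t] = O(β)` by `tr U² = t² − 2`, `tr U³ = t³ − 3t`. [folklore] -/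
theorem norm_integral_trace_cube_su_two_le (hL : (1 : ZMod L) ≠ 0) (β : ℝ) (x : Site d L) {μ ν₀ : Fin d} (hμν₀ : μ ≠ ν₀) :
    ‖∫ U, (fundamentalRep (Fin 2) (wordHolonomy U x (plaqWord μ ν₀ true))).trace *
        (fundamentalRep (Fin 2) (wordHolonomy U x (plaqWord μ ν₀ true))).trace *
        (fundamentalRep (Fin 2) (wordHolonomy U x (plaqWord μ ν₀ true))).trace
          ∂(wilsonMeasure (d := d) (L := L) (fundamentalRep (Fin 2)) β)‖ ≤ 15 * ((d : ℝ) - 1) * |β| := by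
  have hP : Word.endpoint x (plaqWord μ ν₀ true) = x := endpoint_plaqWord x μ ν₀ true
  set t : GaugeConfig d L (Matrix.specialUnitaryGroup (Fin 2) ℂ) → ℂ :=
    fun U => (fundamentalRep (Fin 2) (wordHolonomy U x (plaqWord μ ν₀ true))).trace with ht
  have hI := doublyWound_spectator_identity_suN (d := d) (L := L) (N := 2) hL β x hμν₀
  have hR4 := norm_sum_sum_integral_plaqTerm_mul_trace_le (d := d) (L := L) (fundamentalLatticeRep 2) β 1 x μ
    (plaqWord μ ν₀ true ++ plaqWord μ ν₀ true) x (plaqWord μ ν₀ true)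
  rw [norm_one, show ((fundamentalLatticeRep 2).N : ℝ) = 2 from rfl] at hR4
  have hc : ∀ u : Word d, Continuous fun U : GaugeConfig d L (Matrix.specialUnitaryGroup (Fin 2) ℂ) =>
      (fundamentalRep (Fin 2) (wordHolonomy U x u)).trace := fun u => continuous_trace_wordHolonomy (fundamentalLatticeRep 2) x u
  -- `tr(P²) = t² − 2`, `tr(ρ(P²)ρ(P)) = t³ − 3t`
  have hsq : ∀ U : GaugeConfig d L (Matrix.specialUnitaryGroup (Fin 2) ℂ),
      (fundamentalRep (Fin 2) (wordHolonomy U x (plaqWord μ ν₀ true ++ plaqWord μ ν₀ true))).trace = t U * t U - 2 := fun U => by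
    rw [ht, trace_mul_trace_su_two, mul_inv_cancel, map_one, Matrix.trace_one, Fintype.card_fin, wordHolonomy_append, hP]
    push_cast; ring
  have hcube : ∀ U : GaugeConfig d L (Matrix.specialUnitaryGroup (Fin 2) ℂ),
      (fundamentalRep (Fin 2) (wordHolonomy U x (plaqWord μ ν₀ true ++ plaqWord μ ν₀ true)) *
          fundamentalRep (Fin 2) (wordHolonomy U x (plaqWord μ ν₀ true))).trace = t U * t U * t U - 3 * t U := fun U => by
    have hw : wordHolonomy U x (plaqWord μ ν₀ true ++ plaqWord μ ν₀ true) =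
        wordHolonomy U x (plaqWord μ ν₀ true) * wordHolonomy U x (plaqWord μ ν₀ true) := by rw [wordHolonomy_append, hP]
    have h2 := trace_mul_trace_su_two (wordHolonomy U x (plaqWord μ ν₀ true) * wordHolonomy U x (plaqWord μ ν₀ true))
      (wordHolonomy U x (plaqWord μ ν₀ true))
    rw [mul_inv_cancel_right] at h2
    have e : (fundamentalRep (Fin 2) (wordHolonomy U x (plaqWord μ ν₀ true) * wordHolonomy U x (plaqWord μ ν₀ true))).trace =
        t U * t U - 2 := by rw [← hw]; exact hsq U
    have et : (fundamentalRep (Fin 2) (wordHolonomy U x (plaqWord μ ν₀ true))).trace = t U := rfl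
    rw [e, et] at h2
    rw [← map_mul, hw]
    linear_combination -h2
  have hNewton : ∀ U : GaugeConfig d L (Matrix.specialUnitaryGroup (Fin 2) ℂ),
      (fundamentalRep (Fin 2) (wordHolonomy U x (plaqWord μ ν₀ true ++ plaqWord μ ν₀ true))).trace * t U =
        t U * t U * t U - 2 * t U := fun U => by rw [hsq]; ring
  have hiK : Integrable (fun U => t U * t U * t U) (wilsonMeasure (d := d) (L := L) (fundamentalRep (Fin 2)) β) :=
    integrable_of_continuous (fundamentalLatticeRep 2) β (((hc _).mul (hc _)).mul (hc _))
  have hiT : Integrable (fun U => t U) (wilsonMeasure (d := d) (L := L) (fundamentalRep (Fin 2)) β) :=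
    integrable_of_continuous (fundamentalLatticeRep 2) β (hc _)
  have hy : ∫ U, (fundamentalRep (Fin 2) (wordHolonomy U x (plaqWord μ ν₀ true ++ plaqWord μ ν₀ true))).trace * t U
      ∂(wilsonMeasure (d := d) (L := L) (fundamentalRep (Fin 2)) β) =
      (∫ U, t U * t U * t U ∂(wilsonMeasure (d := d) (L := L) (fundamentalRep (Fin 2)) β)) -
        2 * ∫ U, t U ∂(wilsonMeasure (d := d) (L := L) (fundamentalRep (Fin 2)) β) := by
    simp_rw [hNewton]
    rw [integral_sub hiK (hiT.const_mul _), integral_const_mul]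
  have hz : ∫ U, (fundamentalRep (Fin 2) (wordHolonomy U x (plaqWord μ ν₀ true ++ plaqWord μ ν₀ true)) *
      fundamentalRep (Fin 2) (wordHolonomy U x (plaqWord μ ν₀ true))).trace
        ∂(wilsonMeasure (d := d) (L := L) (fundamentalRep (Fin 2)) β) =
      (∫ U, t U * t U * t U ∂(wilsonMeasure (d := d) (L := L) (fundamentalRep (Fin 2)) β)) -
        3 * ∫ U, t U ∂(wilsonMeasure (d := d) (L := L) (fundamentalRep (Fin 2)) β) := by
    simp_rw [hcube]
    rw [integral_sub hiK (hiT.const_mul _), integral_const_mul]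
  have hτ := norm_integral_trace_plaqWord_su_two_le (d := d) (L := L) hL β x hμν₀
  have key : (5 / 2 : ℂ) * (∫ U, t U * t U * t U ∂(wilsonMeasure (d := d) (L := L) (fundamentalRep (Fin 2)) β)) =
      -((β / 2 : ℂ) * ∑ ν ∈ Finset.univ.erase μ, ∑ ε : Bool,
        ∫ U, plaqTerm (fundamentalRep (Fin 2)) 1 x μ U (plaqWord μ ν₀ true ++ plaqWord μ ν₀ true) ν ε * t U
          ∂(wilsonMeasure (d := d) (L := L) (fundamentalRep (Fin 2)) β)) +
      4 * ∫ U, t U ∂(wilsonMeasure (d := d) (L := L) (fundamentalRep (Fin 2)) β) := by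
    rw [← hI, hy, hz]
    have hN : ((2 : ℕ) : ℂ) = 2 := by norm_num
    rw [hN]
    ring
  have hn := congrArg (fun z : ℂ => ‖z‖) key
  have h52 : ‖(5 / 2 : ℂ)‖ = 5 / 2 := by
    rw [show (5 / 2 : ℂ) = ((5 / 2 : ℝ) : ℂ) by push_cast; ring, Complex.norm_real, Real.norm_eq_abs]; norm_num
  simp only [norm_mul, h52] at hn
  have hβ2 : ‖(β / 2 : ℂ)‖ = |β| / 2 := norm_half_ofReal β
  have hR4' := mul_le_mul_of_nonneg_left hR4 (by positivity : (0 : ℝ) ≤ |β| / 2)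
  have hbound : 5 / 2 * ‖∫ U, t U * t U * t U ∂(wilsonMeasure (d := d) (L := L) (fundamentalRep (Fin 2)) β)‖ ≤
      |β| / 2 * (((d : ℝ) - 1) * (2 * (2 * 2 * (1 + 1) * 2))) + 4 * (16 * ((d : ℝ) - 1) * |β| / 3) := by
    rw [hn]
    refine (norm_add_le _ _).trans (add_le_add ?_ ?_)
    · rw [norm_neg, norm_mul, hβ2]; exact hR4'
    · rw [norm_mul, Complex.norm_ofNat]; exact mul_le_mul_of_nonneg_left hτ (by norm_num)
  nlinarith [abs_nonneg β, sub_one_nonneg_of_axis (d := d) μ]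

/-- ★ **The self-deformation term with spectator `t`** (`SU(2)`): `‖E[plaqTerm_{ν₀,+}(P̃₀)·tr U_P]‖ ≤ 37(d−1)|β|`
(`= κ − 4τ`, Haar value `0`). [folklore] -/
theorem norm_integral_plaqTermZero_mul_trace_su_two_le (hL : (1 : ZMod L) ≠ 0) (β : ℝ) (x : Site d L) {μ ν₀ : Fin d}
    (hμν₀ : μ ≠ ν₀) :
    ‖∫ U, plaqTerm (fundamentalRep (Fin 2)) 1 x μ U (plaqWord μ ν₀ true) ν₀ true *
        (fundamentalRep (Fin 2) (wordHolonomy U x (plaqWord μ ν₀ true))).trace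
          ∂(wilsonMeasure (d := d) (L := L) (fundamentalRep (Fin 2)) β)‖ ≤ 37 * ((d : ℝ) - 1) * |β| := by
  have hP : Word.endpoint x (plaqWord μ ν₀ true) = x := endpoint_plaqWord x μ ν₀ true
  set t : GaugeConfig d L (Matrix.specialUnitaryGroup (Fin 2) ℂ) → ℂ :=
    fun U => (fundamentalRep (Fin 2) (wordHolonomy U x (plaqWord μ ν₀ true))).trace with ht
  have hc : ∀ u : Word d, Continuous fun U : GaugeConfig d L (Matrix.specialUnitaryGroup (Fin 2) ℂ) =>
      (fundamentalRep (Fin 2) (wordHolonomy U x u)).trace := fun u => continuous_trace_wordHolonomy (fundamentalLatticeRep 2) x u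
  rw [integral_plaqTerm_mul_trace_suN]
  have htriv : ∀ U : GaugeConfig d L (Matrix.specialUnitaryGroup (Fin 2) ℂ),
      (fundamentalRep (Fin 2) (wordHolonomy U x (plaqWord μ ν₀ true ++ (plaqWord μ ν₀ true).reverse))).trace = 2 := fun U => by
    rw [wordHolonomy_append_reverse, map_one, Matrix.trace_one, Fintype.card_fin]; rfl
  simp_rw [htriv, trace_wordHolonomy_plaqWord_reverse_su_two, sub_self, mul_zero, sub_zero]
  have hsq0 : ∀ U : GaugeConfig d L (Matrix.specialUnitaryGroup (Fin 2) ℂ),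
      (fundamentalRep (Fin 2) (wordHolonomy U x (plaqWord μ ν₀ true ++ plaqWord μ ν₀ true))).trace = t U * t U - 2 := fun U => by
    rw [ht, trace_mul_trace_su_two, mul_inv_cancel, map_one, Matrix.trace_one, Fintype.card_fin, wordHolonomy_append, hP]
    push_cast; ring
  have hsq : ∀ U : GaugeConfig d L (Matrix.specialUnitaryGroup (Fin 2) ℂ),
      (fundamentalRep (Fin 2) (wordHolonomy U x (plaqWord μ ν₀ true ++ plaqWord μ ν₀ true))).trace * t U =
        t U * t U * t U - 2 * t U := fun U => by rw [hsq0]; ring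
  have hiK : Integrable (fun U => t U * t U * t U) (wilsonMeasure (d := d) (L := L) (fundamentalRep (Fin 2)) β) :=
    integrable_of_continuous (fundamentalLatticeRep 2) β (((hc _).mul (hc _)).mul (hc _))
  have hiT : Integrable (fun U => t U) (wilsonMeasure (d := d) (L := L) (fundamentalRep (Fin 2)) β) :=
    integrable_of_continuous (fundamentalLatticeRep 2) β (hc _)
  have hy : ∫ U, (fundamentalRep (Fin 2) (wordHolonomy U x (plaqWord μ ν₀ true ++ plaqWord μ ν₀ true))).trace * t U
      ∂(wilsonMeasure (d := d) (L := L) (fundamentalRep (Fin 2)) β) =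
      (∫ U, t U * t U * t U ∂(wilsonMeasure (d := d) (L := L) (fundamentalRep (Fin 2)) β)) -
        2 * ∫ U, t U ∂(wilsonMeasure (d := d) (L := L) (fundamentalRep (Fin 2)) β) := by
    simp_rw [hsq]
    rw [integral_sub hiK (hiT.const_mul _), integral_const_mul]
  have h2t : ∫ U, (2 : ℂ) * t U ∂(wilsonMeasure (d := d) (L := L) (fundamentalRep (Fin 2)) β) =
      2 * ∫ U, t U ∂(wilsonMeasure (d := d) (L := L) (fundamentalRep (Fin 2)) β) := integral_const_mul _ _
  rw [hy, h2t]
  have hκ := norm_integral_trace_cube_su_two_le (d := d) (L := L) hL β x hμν₀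
  have hτ := norm_integral_trace_plaqWord_su_two_le (d := d) (L := L) hL β x hμν₀
  have h4 : ‖(∫ U, t U * t U * t U ∂(wilsonMeasure (d := d) (L := L) (fundamentalRep (Fin 2)) β)) -
      2 * (∫ U, t U ∂(wilsonMeasure (d := d) (L := L) (fundamentalRep (Fin 2)) β)) -
      2 * ∫ U, t U ∂(wilsonMeasure (d := d) (L := L) (fundamentalRep (Fin 2)) β)‖ ≤
      15 * ((d : ℝ) - 1) * |β| + 2 * (16 * ((d : ℝ) - 1) * |β| / 3) + 2 * (16 * ((d : ℝ) - 1) * |β| / 3) := by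
    refine (norm_sub_le _ _).trans (add_le_add ((norm_sub_le _ _).trans (add_le_add hκ ?_)) ?_) <;>
    · rw [norm_mul, Complex.norm_ofNat]; exact mul_le_mul_of_nonneg_left hτ (by norm_num)
  nlinarith [abs_nonneg β, sub_one_nonneg_of_axis (d := d) μ]

/-- ★★ **`S₁ = O(β)`, `SU(2)`**: `‖ΣΣE[plaqTerm_{ν,ε}(P̃₀)·tr U_P]‖ ≤ (37 + (128/3)(2d−3))(d−1)|β|` — with the self-spectator identity
`2E[(tr U_P)²] − 2 = −(β/2)S₁`: `E[(tr U_P)²] = 1 + O(β²)`. [folklore] -/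
theorem norm_selfSpectatorSum_su_two_le (hL : (1 : ZMod L) ≠ 0) (β : ℝ) (x : Site d L) {μ ν₀ : Fin d} (hμν₀ : μ ≠ ν₀) :
    ‖∑ ν ∈ Finset.univ.erase μ, ∑ ε : Bool, ∫ U, plaqTerm (fundamentalRep (Fin 2)) 1 x μ U (plaqWord μ ν₀ true) ν ε *
        (fundamentalRep (Fin 2) (wordHolonomy U x (plaqWord μ ν₀ true))).trace
          ∂(wilsonMeasure (d := d) (L := L) (fundamentalRep (Fin 2)) β)‖ ≤
      (37 + 128 / 3 * (2 * (d : ℝ) - 3)) * ((d : ℝ) - 1) * |β| := by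
  have hν₀ : ν₀ ∈ Finset.univ.erase μ := Finset.mem_erase.2 ⟨fun h => hμν₀ h.symm, Finset.mem_univ _⟩
  rw [sum_sum_eq_add hν₀]
  have h0 := norm_integral_plaqTermZero_mul_trace_su_two_le (d := d) (L := L) hL β x hμν₀
  have hoff := norm_offDiagonal_le hμν₀ (fun ν ε => ∫ U, plaqTerm (fundamentalRep (Fin 2)) 1 x μ U (plaqWord μ ν₀ true) ν ε *
      (fundamentalRep (Fin 2) (wordHolonomy U x (plaqWord μ ν₀ true))).trace ∂(wilsonMeasure (d := d) (L := L) (fundamentalRep (Fin 2)) β))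
    (B := 128 / 3 * ((d : ℝ) - 1) * |β|)
    (fun ν hν => by
      obtain ⟨hνν₀, hν'⟩ := Finset.mem_erase.1 hν
      exact norm_integral_plaqTerm_mul_trace_su_two_le₁ hL β x hμν₀ (Finset.mem_erase.1 hν').1 (fun h => hνν₀ h.1))
    (fun ν hν => norm_integral_plaqTerm_mul_trace_su_two_le₁ hL β x hμν₀ (Finset.mem_erase.1 hν).1 (fun h => Bool.false_ne_true h.2))
  refine (norm_add_le _ _).trans ((add_le_add h0 hoff).trans (le_of_eq ?_))
  ring

/-- ★★ **The exact identity behind the third order** (`SU(2)`): `τ − β = (β²/12)·S₁ − (β/3)·Σ'T` (`τ = E[tr U_P]`; the plaquette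
equation `(3/2)τ + (β/2)(a − 4 + Σ'T) = 0` and the self-spectator identity `2a − 2 = −(β/2)S₁`). [folklore] -/
theorem integral_trace_sub_eq_su_two (hL : (1 : ZMod L) ≠ 0) (β : ℝ) (x : Site d L) {μ ν₀ : Fin d} (hμν₀ : μ ≠ ν₀) :
    (∫ U, (fundamentalRep (Fin 2) (wordHolonomy U x (plaqWord μ ν₀ true))).trace
        ∂(wilsonMeasure (d := d) (L := L) (fundamentalRep (Fin 2)) β)) - β =
      (β ^ 2 / 12 : ℂ) * (∑ ν ∈ Finset.univ.erase μ, ∑ ε : Bool,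
          ∫ U, plaqTerm (fundamentalRep (Fin 2)) 1 x μ U (plaqWord μ ν₀ true) ν ε *
            (fundamentalRep (Fin 2) (wordHolonomy U x (plaqWord μ ν₀ true))).trace
              ∂(wilsonMeasure (d := d) (L := L) (fundamentalRep (Fin 2)) β)) -
      (β / 3 : ℂ) * (∑ ν ∈ (Finset.univ.erase μ).erase ν₀,
            ∫ U, plaqTerm (fundamentalRep (Fin 2)) 1 x μ U (plaqWord μ ν₀ true) ν true
              ∂(wilsonMeasure (d := d) (L := L) (fundamentalRep (Fin 2)) β) +
          ∑ ν ∈ Finset.univ.erase μ,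
            ∫ U, plaqTerm (fundamentalRep (Fin 2)) 1 x μ U (plaqWord μ ν₀ true) ν false
              ∂(wilsonMeasure (d := d) (L := L) (fundamentalRep (Fin 2)) β)) := by
  haveI := isProbabilityMeasure_wilsonMeasure (d := d) (L := L) (fundamentalRep (Fin 2)) (continuous_fundamentalRep (Fin 2)) β
  have hν₀ : ν₀ ∈ Finset.univ.erase μ := Finset.mem_erase.2 ⟨fun h => hμν₀ h.symm, Finset.mem_univ _⟩
  -- (Eq0)
  have h0 := Equipartition.loopEquation_plaqWord (d := d) (L := L) (fundamentalLatticeRep 2) hL β x hμν₀ true 1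
    fun i j => sdPair_specialUnitaryGroup 2 β x μ x _ _ (trace_unitDir_one i j)
  simp only [fundamentalLatticeRep_N, fundamentalLatticeRep_ρ, Nat.cast_ofNat] at h0
  have h0' : ((2 : ℂ) - 1 / 2) * (∫ U, (fundamentalRep (Fin 2) (wordHolonomy U x (plaqWord μ ν₀ true))).trace
      ∂(wilsonMeasure (d := d) (L := L) (fundamentalRep (Fin 2)) β)) +
      (β / 2 : ℂ) * ∑ ν ∈ Finset.univ.erase μ, ∑ ε : Bool,
        ∫ U, plaqTerm (fundamentalRep (Fin 2)) 1 x μ U (plaqWord μ ν₀ true) ν ε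
          ∂(wilsonMeasure (d := d) (L := L) (fundamentalRep (Fin 2)) β) = 0 := h0
  rw [sum_sum_eq_add hν₀] at h0'
  have hT₀ := integral_plaqTerm_latticeRep (d := d) (L := L) (fundamentalLatticeRep 2) β 1 x μ (plaqWord μ ν₀ true) ν₀ true
  simp only [fundamentalLatticeRep_N, fundamentalLatticeRep_ρ, Nat.cast_ofNat] at hT₀
  have hT₀' : ∫ U, plaqTerm (fundamentalRep (Fin 2)) 1 x μ U (plaqWord μ ν₀ true) ν₀ true
      ∂(wilsonMeasure (d := d) (L := L) (fundamentalRep (Fin 2)) β) =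
      (∫ U, (fundamentalRep (Fin 2) (wordHolonomy U x (plaqWord μ ν₀ true ++ plaqWord μ ν₀ true))).trace
          ∂(wilsonMeasure (d := d) (L := L) (fundamentalRep (Fin 2)) β)) -
        (∫ U, (fundamentalRep (Fin 2) (wordHolonomy U x (plaqWord μ ν₀ true ++ (plaqWord μ ν₀ true).reverse))).trace
          ∂(wilsonMeasure (d := d) (L := L) (fundamentalRep (Fin 2)) β)) -
        1 / (2 : ℂ) * ((∫ U, (fundamentalRep (Fin 2) (wordHolonomy U x (plaqWord μ ν₀ true))).trace *
            (fundamentalRep (Fin 2) (wordHolonomy U x (plaqWord μ ν₀ true))).trace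
              ∂(wilsonMeasure (d := d) (L := L) (fundamentalRep (Fin 2)) β)) -
          ∫ U, (fundamentalRep (Fin 2) (wordHolonomy U x (plaqWord μ ν₀ true))).trace *
            (fundamentalRep (Fin 2) (wordHolonomy U x (plaqWord μ ν₀ true).reverse)).trace
              ∂(wilsonMeasure (d := d) (L := L) (fundamentalRep (Fin 2)) β)) := hT₀
  have htriv : ∫ U, (fundamentalRep (Fin 2) (wordHolonomy U x (plaqWord μ ν₀ true ++ (plaqWord μ ν₀ true).reverse))).trace
      ∂(wilsonMeasure (d := d) (L := L) (fundamentalRep (Fin 2)) β) = 2 := by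
    have : ∀ U : GaugeConfig d L (Matrix.specialUnitaryGroup (Fin 2) ℂ),
        (fundamentalRep (Fin 2) (wordHolonomy U x (plaqWord μ ν₀ true ++ (plaqWord μ ν₀ true).reverse))).trace = (2 : ℂ) :=
      fun U => by rw [wordHolonomy_append_reverse, map_one, Matrix.trace_one, Fintype.card_fin]; rfl
    simp_rw [this]
    rw [integral_const, probReal_univ, one_smul]
  have hdouble := integral_trace_double_su_two (d := d) (L := L) β x μ ν₀
  simp_rw [trace_wordHolonomy_plaqWord_reverse_su_two] at hT₀'
  rw [hT₀', htriv, hdouble] at h0'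
  -- (Eq1) the self-spectator identity
  have h1 := spectator_self_identity (d := d) (L := L) (fundamentalLatticeRep 2) hL β x hμν₀ 1
    fun i j => sdPair₂_specialUnitaryGroup 2 β x μ x _ x _ _ (trace_unitDir_one i j)
  simp only [fundamentalLatticeRep_N, fundamentalLatticeRep_ρ, Nat.cast_ofNat] at h1
  have h1' : ((2 : ℂ) - 2 * 1 / 2) * (∫ U, (fundamentalRep (Fin 2) (wordHolonomy U x (plaqWord μ ν₀ true))).trace *
      (fundamentalRep (Fin 2) (wordHolonomy U x (plaqWord μ ν₀ true))).trace ∂(wilsonMeasure (d := d) (L := L) (fundamentalRep (Fin 2)) β)) +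
      (∫ U, (fundamentalRep (Fin 2) (wordHolonomy U x (plaqWord μ ν₀ true ++ plaqWord μ ν₀ true))).trace
        ∂(wilsonMeasure (d := d) (L := L) (fundamentalRep (Fin 2)) β)) =
      -((β / 2 : ℂ) * ∑ ν ∈ Finset.univ.erase μ, ∑ ε : Bool,
        ∫ U, plaqTerm (fundamentalRep (Fin 2)) 1 x μ U (plaqWord μ ν₀ true) ν ε *
          (fundamentalRep (Fin 2) (wordHolonomy U x (plaqWord μ ν₀ true))).trace
            ∂(wilsonMeasure (d := d) (L := L) (fundamentalRep (Fin 2)) β)) := h1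
  rw [hdouble] at h1'
  linear_combination (2 / 3 : ℂ) * h0' + (-(β : ℂ) / 6) * h1'

/-- ★★★ **THE `SU(2)` PLAQUETTE AT STRONG COUPLING THROUGH THIRD ORDER — NO `β²` TERM.**  For `d ≥ 2`, every torus side `L ≥ 2`
and EVERY real (tree) coupling `β` (`= β_std/2`): `|⟨ū_P⟩_{β,L} − β/2| ≤ 20d²(d−1)|β|³`. [folklore] -/
theorem abs_wilsonExpectation_meanPlaquette_su_two_third_le (hL : (1 : ZMod L) ≠ 0) (hd : 2 ≤ d) (β : ℝ) :
    |wilsonExpectation (fundamentalRep (Fin 2)) β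
        (meanPlaquette (d := d) (L := L) (G := Matrix.specialUnitaryGroup (Fin 2) ℂ) (fundamentalRep (Fin 2))) - β / 2| ≤
      20 * (d : ℝ) ^ 2 * ((d : ℝ) - 1) * |β| ^ 3 := by
  obtain ⟨μ, ν₀, hμν₀⟩ : ∃ μ ν₀ : Fin d, μ ≠ ν₀ := ⟨⟨0, by omega⟩, ⟨1, by omega⟩, by simp [Fin.ext_iff]⟩
  have hd2 : (2 : ℝ) ≤ d := by exact_mod_cast hd
  set x : Site d L := fun _ => 0 with hx
  set W := wilsonExpectation (fundamentalRep (Fin 2)) β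
    (meanPlaquette (d := d) (L := L) (G := Matrix.specialUnitaryGroup (Fin 2) ℂ) (fundamentalRep (Fin 2))) with hW
  have hid := integral_trace_sub_eq_su_two (d := d) (L := L) hL β x hμν₀
  have hreτ : (∫ U, (fundamentalRep (Fin 2) (wordHolonomy U x (plaqWord μ ν₀ true))).trace
      ∂(wilsonMeasure (d := d) (L := L) (fundamentalRep (Fin 2)) β)).re = 2 * W := by
    have h1 := Equipartition.integral_re_trace_plaqWord (d := d) (L := L) (fundamentalLatticeRep 2) β x hμν₀ true (by norm_num)
    have h2 := Equipartition.re_integral_eq (fundamentalLatticeRep 2) β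
      (continuous_trace_wordHolonomy (fundamentalLatticeRep 2) x (plaqWord μ ν₀ true))
    simp only [fundamentalLatticeRep_N, fundamentalLatticeRep_ρ, Nat.cast_ofNat] at h1 h2
    rw [← h2] at h1
    exact h1
  have hB1 := norm_selfSpectatorSum_su_two_le (d := d) (L := L) hL β x hμν₀
  have hBT := norm_offDiagonal_le hμν₀
    (fun ν ε => ∫ U, plaqTerm (fundamentalRep (Fin 2)) 1 x μ U (plaqWord μ ν₀ true) ν ε
      ∂(wilsonMeasure (d := d) (L := L) (fundamentalRep (Fin 2)) β)) (B := 512 / 9 * ((d : ℝ) - 1) ^ 2 * β ^ 2)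
    (fun ν hν => by
      obtain ⟨hνν₀, hν'⟩ := Finset.mem_erase.1 hν
      have hνμ : ν ≠ μ := (Finset.mem_erase.1 hν').1
      have h := integral_plaqTerm_latticeRep (d := d) (L := L) (fundamentalLatticeRep 2) β 1 x μ (plaqWord μ ν₀ true) ν true
      simp only [fundamentalLatticeRep_N, fundamentalLatticeRep_ρ, Nat.cast_ofNat] at h
      have hb := norm_plaqTermIntegral_le₂ (d := d) (L := L) (N := 2) le_rfl hL β x hμν₀ hνμ (ε := true) (fun h' => hνν₀ h'.1)
      simp only [Nat.cast_ofNat] at hb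
      rw [h]; exact hb.trans (le_of_eq (by ring)))
    (fun ν hν => by
      have hνμ : ν ≠ μ := (Finset.mem_erase.1 hν).1
      have h := integral_plaqTerm_latticeRep (d := d) (L := L) (fundamentalLatticeRep 2) β 1 x μ (plaqWord μ ν₀ true) ν false
      simp only [fundamentalLatticeRep_N, fundamentalLatticeRep_ρ, Nat.cast_ofNat] at h
      have hb := norm_plaqTermIntegral_le₂ (d := d) (L := L) (N := 2) le_rfl hL β x hμν₀ hνμ (ε := false)
        (fun h' => Bool.false_ne_true h'.2)
      simp only [Nat.cast_ofNat] at hb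
      rw [h]; exact hb.trans (le_of_eq (by ring)))
  -- norms
  have n1 : ‖(β ^ 2 / 12 : ℂ)‖ = β ^ 2 / 12 := by
    rw [show (β ^ 2 / 12 : ℂ) = ((β ^ 2 / 12 : ℝ) : ℂ) by push_cast; ring, Complex.norm_real, Real.norm_eq_abs,
      abs_of_nonneg (by positivity)]
  have n3 : ‖(β / 3 : ℂ)‖ = |β| / 3 := by
    rw [show (β / 3 : ℂ) = ((β / 3 : ℝ) : ℂ) by push_cast; ring, Complex.norm_real, Real.norm_eq_abs, abs_div,
      abs_of_pos (by norm_num : (0 : ℝ) < 3)]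
  have hR := congrArg (fun z : ℂ => ‖z‖) hid
  have hRle : ‖(∫ U, (fundamentalRep (Fin 2) (wordHolonomy U x (plaqWord μ ν₀ true))).trace
      ∂(wilsonMeasure (d := d) (L := L) (fundamentalRep (Fin 2)) β)) - β‖ ≤
      β ^ 2 / 12 * ((37 + 128 / 3 * (2 * (d : ℝ) - 3)) * ((d : ℝ) - 1) * |β|) +
        |β| / 3 * ((2 * (d : ℝ) - 3) * (512 / 9 * ((d : ℝ) - 1) ^ 2 * β ^ 2)) := by
    rw [hid]
    refine (norm_sub_le _ _).trans (add_le_add ?_ ?_)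
    · rw [norm_mul, n1]; exact mul_le_mul_of_nonneg_left hB1 (by positivity)
    · rw [norm_mul, n3]; exact mul_le_mul_of_nonneg_left hBT (by positivity)
  have hre : |2 * W - β| ≤ ‖(∫ U, (fundamentalRep (Fin 2) (wordHolonomy U x (plaqWord μ ν₀ true))).trace
      ∂(wilsonMeasure (d := d) (L := L) (fundamentalRep (Fin 2)) β)) - β‖ := by
    have h := Complex.abs_re_le_norm ((∫ U, (fundamentalRep (Fin 2) (wordHolonomy U x (plaqWord μ ν₀ true))).trace
      ∂(wilsonMeasure (d := d) (L := L) (fundamentalRep (Fin 2)) β)) - β)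
    rwa [Complex.sub_re, Complex.ofReal_re, hreτ] at h
  have hb3 : |β| ^ 3 = |β| * β ^ 2 := by rw [pow_succ', sq_abs]
  have hRHS : β ^ 2 / 12 * ((37 + 128 / 3 * (2 * (d : ℝ) - 3)) * ((d : ℝ) - 1) * |β|) +
      |β| / 3 * ((2 * (d : ℝ) - 3) * (512 / 9 * ((d : ℝ) - 1) ^ 2 * β ^ 2)) =
      ((d : ℝ) - 1) * (|β| * β ^ 2) * (1 / 12 * (37 + 128 / 3 * (2 * (d : ℝ) - 3)) + 512 / 27 * ((2 * (d : ℝ) - 3) * ((d : ℝ) - 1))) := by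
    ring
  have hbr : 1 / 12 * (37 + 128 / 3 * (2 * (d : ℝ) - 3)) + 512 / 27 * ((2 * (d : ℝ) - 3) * ((d : ℝ) - 1)) ≤ 40 * (d : ℝ) ^ 2 := by
    nlinarith
  have hX : 0 ≤ ((d : ℝ) - 1) * (|β| * β ^ 2) := by
    have : (0 : ℝ) ≤ (d : ℝ) - 1 := by linarith
    positivity
  have hfin := mul_le_mul_of_nonneg_left hbr hX
  have hmain : |2 * W - β| ≤ ((d : ℝ) - 1) * (|β| * β ^ 2) * (40 * (d : ℝ) ^ 2) := by
    have h := hre.trans hRle; rw [hRHS] at h; exact h.trans hfin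
  rw [hb3]
  have e : |W - β / 2| = |2 * W - β| / 2 := by
    rw [show W - β / 2 = (2 * W - β) / 2 by ring, abs_div, abs_two]
  rw [e, div_le_iff₀ (by norm_num : (0 : ℝ) < 2)]
  refine hmain.trans (le_of_eq ?_)
  ring

/-- ★★★ **The cell's form, third order** (`SU(2)`, `D ≥ 2`, every `L ≥ 2`, every real `β_std`):
`|plaquetteExpectation 2 D L β_std − β_std/4| ≤ (5/2)·D²(D−1)·|β_std|³` — the strong-coupling series of the `SU(2)` plaquette has
NO `β_std²` term. [folklore] -/
theorem abs_plaquetteExpectation_two_third_le {D L : ℕ} [NeZero L] (hL : 2 ≤ L) (hD : 2 ≤ D) (β : ℝ) :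
    |plaquetteExpectation 2 D L β - β / 4| ≤ 5 / 2 * (D : ℝ) ^ 2 * ((D : ℝ) - 1) * |β| ^ 3 := by
  have h := abs_wilsonExpectation_meanPlaquette_su_two_third_le (d := D) (L := L) (zmod_one_ne_zero hL) hD (β / 2)
  unfold plaquetteExpectation
  have e1 : β / (2 : ℕ) = β / 2 := by norm_num
  rw [e1]
  have e2 : β / 2 / 2 = β / 4 := by ring
  rw [e2] at h
  refine h.trans (le_of_eq ?_)
  rw [abs_div, abs_two]
  ring

/-- `T2` (`SU(2)`, `D = 4`): `|plaquetteExpectation 2 4 L β_std − β_std/4| ≤ 120·|β_std|³` for every `L ≥ 2` and every real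
`β_std`. [folklore] -/
theorem abs_plaquetteExpectation_two_four_third_le {L : ℕ} [NeZero L] (hL : 2 ≤ L) (β : ℝ) :
    |plaquetteExpectation 2 4 L β - β / 4| ≤ 120 * |β| ^ 3 := by
  have h := abs_plaquetteExpectation_two_third_le (D := 4) (L := L) hL (by norm_num) β
  norm_num at h
  linarith

end StrongCoupling

end Summit.QuantumFields.GaugeBoot

end
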